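import Mathlib
import Literature.MathematicalPhysics.QuantumLattice.GrassmannGaussianQuadraticInsertion
import Literature.MathematicalPhysics.QuantumLattice.GrassmannLinearSubstitution
import Literature.MathematicalPhysics.QuantumLattice.GrassmannPairLaplacians
import Literature.MathematicalPhysics.QuantumLattice.GrassmannEffectiveActionBlocks
import HarnessLib

/-!
# A quadratic insertion renormalises the covariance — CONVOLUTION LEVEL, all degrees:
# `μ_C ⋆ (e^{q} F) = (μ_C ⋆ e^{q}) · S_M(μ_{C′} ⋆ F)` and `effAction C (V − q) = effAction C (−q) + S_M(effAction C′ V)`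

Topic `Literature/MathematicalPhysics/QuantumLattice`; sequel of `GrassmannGaussianQuadraticInsertion.lean` (EXPECTATION level:
`∫ dμ_C e^{q} F = (∫ dμ_C e^{q}) · ∫ dμ_{C′} F` by uniqueness of Wick functionals) and of `GrassmannGaussianQuadraticInsertionTwoLeg.lean`
(the two-leg kernel of `effAction C (V − q)`; its header flags «not here: the convolution-level form»).  Here is the convolution-level
form, in every degree at once, by the same method one level up: a `G`-valued map obeying a TWISTED Wick rule
`Ψ(ψ(X) a) = t(X)·Ψ(a) + Σ_Y A′(X,Y) Ψ(∂_Y a)` is determined by `Ψ(1)` (`eq_zero_of_twistedWick`, `eq_of_twistedWick`; induction over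
`CliffordAlgebra.left_induction` carrying all iterated derivatives, as in `eq_zero_of_wick`).

For the quadratic insertion `q = Σ_{X,Y} N(X,Y) ψ(X)ψ(Y)` (hypothesis `hq`), the pair function `A(X,Y) = ½(C(Y,X) − C(X,Y))` of `C`,
`S = N − Nᵀ` and a resolvent `M (1 − A S) = 1`:
* `gaussConv_grassmannExp_mul_gen_mul` — the convolution twisted Wick rule for `Ψ(F) := μ_C ⋆ (e^{q}F)`:
  `Ψ(ψ(X)F) = ψ(X)Ψ(F) + Σ_Y A(X,Y)(Ψ(∂_Y F) + Σ_Z S(Y,Z)Ψ(ψ(Z)F))` (`gaussConv_gen_mul` + `∂_Y e^{q} = e^{q}Σ_Z S(Y,Z)ψ(Z)`);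
* `gaussConv_grassmannExp_mul_gen_mul_of_resolvent` — its resolvent form `Ψ(ψ(X)F) = (Mψ)(X)·Ψ(F) + Σ_Y (MA)(X,Y) Ψ(∂_Y F)`,
  `(Mψ)(X) = Σ_Z M(X,Z)ψ(Z)`: the substitution `S_M` (`ExteriorAlgebra.map (Matrix.toLin' Mᵀ)`, `map_toLin'_transpose_gen`) AND the
  renormalised pair function `A′ = M A` appear together;
* **`gaussConv_grassmannExp_mul`** — for ANY `C′` with pair function `M A`:  `μ_C ⋆ (e^{q} F) = (μ_C ⋆ e^{q}) · S_M(μ_{C′} ⋆ F)`  for every `F`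
  (both sides obey the resolvent rule — the right side because `μ_C ⋆ e^{q}` is even, hence central, `S_M` is an algebra map with
  `S_M ψ(X) = (Mψ)(X)`, and derivatives commute with `μ_{C′} ⋆` — and agree at `F = 1`); canonical `C′ = −M A`
  (`gaussConv_grassmannExp_mul_canonical`) and, for antisymmetric `C`, `C′ = M C` with `M (1 + C S) = 1` (`…_of_transpose_eq_neg`);
* `effBoltzmann_sub_quadratic`, `effPartitionFn_sub_quadratic`, **`effAction_sub_quadratic`** — for `V` without constant part and unit
  partition functions:  `effAction C (V − q) = effAction C (−q) + S_M (effAction (M C) V)`.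
  The first summand is the (explicitly quadratic, `V`-independent) effective action of the pure Gaussian perturbation `−q` (its two-leg kernel is
  the «chain» `−Sᵀ − S A′ Sᵀ` of the TwoLeg file); the second is the effective action of the PURELY non-quadratic `V` with the RENORMALISED
  covariance `C′ = (1 + C S)⁻¹ C`, its legs dressed by `M = 1 + A′S`.  This is «the quadratic part is moved into the free measure» at the level of
  the Wilsonian effective action (Benfatto–Giuliani–Mastropietro 2006, (2.21)–(2.24): `P_{E_h,C_h} e^{−𝓛₂𝒱−…} ∝ P_{E_{h−1},C_h} e^{−…}`,
  `E_{h−1} = E_h + C_h^{−1} n̂_h`; Feldman–Salmhofer–Trubowitz 1996 §1; Salmhofer 1999 §4.3), for the Laplacian form and singular (cutoff)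
  covariances — no inverse of `C` is used.

Everything is proved; no definition is introduced (the substitution is written `ExteriorAlgebra.map (Matrix.toLin' Mᵀ)`); no named facts.

## Sources

G. Benfatto, A. Giuliani, V. Mastropietro, Ann. Henri Poincaré 7 (2006) 809–898, §2.3 (2.21)–(2.28) [`BenfattoGiulianiMastropietro2006`];
J. Feldman, H. Knörrer, E. Trubowitz, *Fermionic Functional Integrals and the Renormalization Group* (AMS 2002), §I.2–I.3
[`FeldmanKnorrerTrubowitz2002`]; J. Feldman, M. Salmhofer, E. Trubowitz, J. Stat. Phys. 84 (1996) 1209, §1 [`FeldmanSalmhoferTrubowitz1996`];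
M. Salmhofer, *Renormalization* (1999), §4.3 (4.86)–(4.91) [`Salmhofer1999`].  [folklore]
-/

noncomputable section

namespace Literature.MathematicalPhysics.QuantumLattice

open GrassmannAlgebra Finset

variable (R : Type*) [CommRing R] [Algebra ℚ R] {Γ : Type*} [Fintype Γ] [DecidableEq Γ]

/-! ### Uniqueness of `G`-valued twisted Wick maps -/

omit [Algebra ℚ R] in
/-- **A twisted Wick map vanishing at `1` vanishes identically.**  If an `R`-linear map `D : G → G` of the Grassmann algebra obeys
`D(ψ(X) a) = t(X)·D(a) + Σ_Y A(X,Y) D(∂_Y a)` for some family `t : Γ → G` and matrix `A`, and `D 1 = 0`, then `D = 0`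
(induction over `CliffordAlgebra.left_induction`, carrying all iterated derivatives — the `G`-valued twin of `eq_zero_of_wick`).
[cite: FeldmanKnorrerTrubowitz2002, §I.2] -/
theorem eq_zero_of_twistedWick (D : GrassmannAlgebra R Γ →ₗ[R] GrassmannAlgebra R Γ) (t : Γ → GrassmannAlgebra R Γ)
    (A : Matrix Γ Γ R)
    (hD : ∀ (X : Γ) (a : GrassmannAlgebra R Γ),
      D (gen R X * a) = t X * D a + ∑ Y, A X Y • D (grassmannDeriv R Y a))
    (h1 : D 1 = 0) : D = 0 := by
  -- every iterated derivative of `a` is killed by `D`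
  suffices hS : ∀ (a : GrassmannAlgebra R Γ) (l : List Γ), D ((l.map (grassmannDeriv R)).prod a) = 0 by
    refine LinearMap.ext fun a => ?_
    simpa using hS a []
  intro a
  induction a using CliffordAlgebra.left_induction with
  | algebraMap r =>
    intro l
    rcases eq_or_ne l [] with rfl | hl
    · rw [List.map_nil, List.prod_nil, Module.End.one_apply, Algebra.algebraMap_eq_smul_one, map_smul, h1, smul_zero]
    · rw [prod_map_grassmannDeriv_algebraMap_of_ne_nil R hl, map_zero]
  | add x y hx hy => intro l; rw [map_add, map_add, hx, hy, add_zero]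
  | ι_mul x v hx =>
    have hx' : ∀ (l : List Γ) (b : GrassmannAlgebra R Γ),
        (∀ l' : List Γ, D ((l'.map (grassmannDeriv R)).prod b) = 0) →
        D ((l.map (grassmannDeriv R)).prod (ExteriorAlgebra.ι R v * b)) = 0 := by
      intro l
      induction l using List.reverseRecOn with
      | nil =>
        intro b hb
        rw [List.map_nil, List.prod_nil, Module.End.one_apply, ι_eq_sum_gen R v, Finset.sum_mul, map_sum]
        refine Finset.sum_eq_zero fun X _ => ?_
        have hb0 : D b = 0 := by simpa using hb []
        rw [smul_mul_assoc, map_smul, hD, hb0, mul_zero, zero_add]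
        refine smul_eq_zero_of_right _ (Finset.sum_eq_zero fun Y _ => ?_)
        have := hb [Y]
        rw [List.map_singleton, List.prod_singleton] at this
        rw [this, smul_zero]
      | append_singleton L Y ih =>
        intro b hb
        rw [prod_map_grassmannDeriv_append_singleton, grassmannDeriv_ι_mul, map_sub, map_sub, LinearMap.map_smul_of_tower,
          map_smul, hb L, smul_zero, zero_sub, neg_eq_zero]
        exact ih (grassmannDeriv R Y b) fun l' => by rw [← prod_map_grassmannDeriv_append_singleton]; exact hb _
    intro l
    exact hx' l x hx

omit [Algebra ℚ R] in
/-- **Uniqueness of twisted Wick maps**: two `R`-linear maps `G → G` obeying the same twisted rule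
`Ψ(ψ(X) a) = t(X)·Ψ(a) + Σ_Y A(X,Y) Ψ(∂_Y a)` and agreeing at `1` are equal. [cite: FeldmanKnorrerTrubowitz2002, §I.2] -/
theorem eq_of_twistedWick (Ψ Θ : GrassmannAlgebra R Γ →ₗ[R] GrassmannAlgebra R Γ) (t : Γ → GrassmannAlgebra R Γ)
    (A : Matrix Γ Γ R)
    (hΨ : ∀ (X : Γ) (a : GrassmannAlgebra R Γ), Ψ (gen R X * a) = t X * Ψ a + ∑ Y, A X Y • Ψ (grassmannDeriv R Y a))
    (hΘ : ∀ (X : Γ) (a : GrassmannAlgebra R Γ), Θ (gen R X * a) = t X * Θ a + ∑ Y, A X Y • Θ (grassmannDeriv R Y a))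
    (h1 : Ψ 1 = Θ 1) : Ψ = Θ := by
  have hW : ∀ (X : Γ) (a : GrassmannAlgebra R Γ),
      (Ψ - Θ) (gen R X * a) = t X * (Ψ - Θ) a + ∑ Y, A X Y • (Ψ - Θ) (grassmannDeriv R Y a) := by
    intro X a
    simp only [LinearMap.sub_apply, hΨ X a, hΘ X a, mul_sub, smul_sub, Finset.sum_sub_distrib]
    abel
  have h := eq_zero_of_twistedWick R (Ψ - Θ) t A hW (by simp [h1])
  exact sub_eq_zero.1 h

/-! ### The substitution `S_M : ψ(X) ↦ Σ_Z M(X,Z) ψ(Z)` -/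

omit [Algebra ℚ R] in
/-- The algebra map `ExteriorAlgebra.map (Matrix.toLin' Mᵀ)` is the substitution `ψ(X) ↦ Σ_Z M(X,Z) ψ(Z)` (a linear change of generators,
Berezin 1966 Ch. I §3; `map_gen_eq_sum` with `toMatrix' (toLin' Mᵀ) = Mᵀ`). [cite: Berezin1966, Ch. I §3] -/
theorem map_toLin'_transpose_gen (M : Matrix Γ Γ R) (X : Γ) :
    ExteriorAlgebra.map (Matrix.toLin' M.transpose) (gen R X) = ∑ Z, M X Z • gen R Z := by
  rw [map_gen_eq_sum, LinearMap.toMatrix'_toLin']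
  rfl

/-! ### The convolution-level twisted Wick rule of `F ↦ μ_C ⋆ (e^{q} F)` -/

section Quadratic

variable {R}
variable (N : Matrix Γ Γ R) {q : GrassmannAlgebra R Γ} (hq : q = ∑ X, ∑ Y, N X Y • (gen R X * gen R Y))
include hq

/-- **The convolution twisted Wick rule**: for `Ψ(F) := μ_C ⋆ (e^{q} F)`,
`Ψ(ψ(X) F) = ψ(X)·Ψ(F) + Σ_Y A(X,Y)·(Ψ(∂_Y F) + Σ_Z (N(Y,Z) − N(Z,Y))·Ψ(ψ(Z) F))`, `A(X,Y) = ½(C(Y,X) − C(X,Y))`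
(`μ_C ⋆` past one field, `gaussConv_gen_mul`; the derivative of the even weight `e^{q}` re-inserts a field).
[cite: Salmhofer1999, §4.3.2 (4.90)–(4.91)] -/
theorem gaussConv_grassmannExp_mul_gen_mul (C : Matrix Γ Γ R) (X : Γ) (F : GrassmannAlgebra R Γ) :
    gaussConv R C (grassmannExp q * (gen R X * F)) =
      gen R X * gaussConv R C (grassmannExp q * F) +
        ∑ Y, (((1 / 2 : ℚ) • (1 : R)) * (C Y X - C X Y)) •
          (gaussConv R C (grassmannExp q * grassmannDeriv R Y F) +
            ∑ Z, (N Y Z - N Z Y) • gaussConv R C (grassmannExp q * (gen R Z * F))) := by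
  have hE := grassmannExp_mem_evenOdd_zero R (quadratic_mem_evenOdd_zero_of_eq N hq) (isNilpotent_of_eq_quadratic N hq)
  rw [← mul_assoc, (commute_grassmannExp_of_eq_quadratic N hq (gen R X)).eq, mul_assoc, gaussConv_gen_mul]
  congr 1
  refine Finset.sum_congr rfl fun Y _ => ?_
  congr 1
  rw [grassmannDeriv_gaussConv, grassmannDeriv_mul_of_involute_eq R Y (CliffordAlgebra.involute_eq_of_mem_even hE), map_add,
    add_comm, grassmannDeriv_grassmannExp_of_eq_quadratic N hq, mul_assoc, Finset.sum_mul, Finset.mul_sum, map_sum]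
  congr 1
  refine Finset.sum_congr rfl fun Z _ => ?_
  rw [smul_mul_assoc, mul_smul_comm, LinearMap.map_smul_of_tower]

end Quadratic

/-! ### The resolvent form: substitution `S_M` and renormalised pair function `A′ = M A` -/

section Resolvent

variable {R}
variable (N : Matrix Γ Γ R) {q : GrassmannAlgebra R Γ} (hq : q = ∑ X, ∑ Y, N X Y • (gen R X * gen R Y))
variable (C : Matrix Γ Γ R) {A S M : Matrix Γ Γ R}
  (hA : A = Matrix.of fun X Y => ((1 / 2 : ℚ) • (1 : R)) * (C Y X - C X Y))
  (hS : S = Matrix.of fun X Y => N X Y - N Y X) (hM : M * (1 - A * S) = 1)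
include hq hA hS hM

/-- **The resolvent form of the convolution twisted Wick rule**: with `M (1 − A S) = 1` (`A` the pair function of `C`, `S = N − Nᵀ`),
`μ_C ⋆ (e^{q} ψ(X) F) = (Σ_Z M(X,Z) ψ(Z)) · μ_C ⋆ (e^{q} F) + Σ_Y (M A)(X,Y) · μ_C ⋆ (e^{q} ∂_Y F)` — the map `F ↦ μ_C ⋆ (e^{q}F)` is a
twisted Wick map with substitution `M` and pair function `M A`. [cite: FeldmanKnorrerTrubowitz2002, §I.3] -/
theorem gaussConv_grassmannExp_mul_gen_mul_of_resolvent (X : Γ) (F : GrassmannAlgebra R Γ) :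
    gaussConv R C (grassmannExp q * (gen R X * F)) =
      (∑ Z, M X Z • gen R Z) * gaussConv R C (grassmannExp q * F) +
        ∑ Y, (M * A) X Y • gaussConv R C (grassmannExp q * grassmannDeriv R Y F) := by
  -- the `G`-valued vectors `φ(Z) = μ ⋆ (e^{q} ψ(Z) F)`, `d(Y) = μ ⋆ (e^{q} ∂_Y F)` and `u = μ ⋆ (e^{q} F)`
  set φ : Γ → GrassmannAlgebra R Γ := fun Z => gaussConv R C (grassmannExp q * (gen R Z * F)) with hφ
  set d : Γ → GrassmannAlgebra R Γ := fun Y => gaussConv R C (grassmannExp q * grassmannDeriv R Y F) with hd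
  set u : GrassmannAlgebra R Γ := gaussConv R C (grassmannExp q * F) with hu
  -- the twisted rule in vector form: `φ(W) − Σ_Z (A S)(W,Z) φ(Z) = ψ(W) u + Σ_Y A(W,Y) d(Y)`
  have key : ∀ W : Γ, φ W - ∑ Z, (A * S) W Z • φ Z = gen R W * u + ∑ Y, A W Y • d Y := by
    intro W
    rw [sub_eq_iff_eq_add]
    have h := gaussConv_grassmannExp_mul_gen_mul N hq C W F
    simp only [hφ, hd, hu]
    rw [h, add_assoc]
    congr 1
    have hAW : ∀ Y, (((1 / 2 : ℚ) • (1 : R)) * (C Y W - C W Y)) = A W Y := fun Y => by rw [hA]; rfl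
    simp only [hAW, smul_add, Finset.sum_add_distrib]
    congr 1
    -- `Σ_Y A(W,Y) Σ_Z S(Y,Z) φ(Z) = Σ_Z (A S)(W,Z) φ(Z)`
    have hSYZ : ∀ Y Z, N Y Z - N Z Y = S Y Z := fun Y Z => by rw [hS]; rfl
    simp only [hSYZ, Finset.smul_sum, smul_smul, Matrix.mul_apply, Finset.sum_smul]
    rw [Finset.sum_comm]
  -- solve with `M`
  have hexp : ∀ Z, (M * (1 - A * S)) X Z = M X Z - ∑ W, M X W * (A * S) W Z := fun Z => by
    rw [Matrix.mul_sub, Matrix.mul_one, Matrix.sub_apply, Matrix.mul_apply]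
  calc φ X = ∑ Z, (M * (1 - A * S)) X Z • φ Z := by
        rw [hM]
        simp only [Matrix.one_apply, ite_smul, one_smul, zero_smul, Finset.sum_ite_eq, Finset.mem_univ, if_true]
    _ = ∑ W, M X W • (φ W - ∑ Z, (A * S) W Z • φ Z) := by
        simp only [hexp, sub_smul, Finset.sum_sub_distrib, smul_sub, Finset.smul_sum, smul_smul, Finset.sum_smul]
        congr 1
        rw [Finset.sum_comm]
    _ = ∑ W, M X W • (gen R W * u + ∑ Y, A W Y • d Y) := by simp only [key]
    _ = (∑ Z, M X Z • gen R Z) * u + ∑ Y, (M * A) X Y • d Y := by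
        simp only [smul_add, Finset.sum_add_distrib, Finset.sum_mul, smul_mul_assoc, Finset.smul_sum, smul_smul,
          Matrix.mul_apply, Finset.sum_smul]
        congr 1
        rw [Finset.sum_comm]

/-- **A quadratic insertion renormalises the covariance — convolution level, general form.**  With `A(X,Y) = ½(C(Y,X) − C(X,Y))`,
`S = N − Nᵀ`, `M (1 − A S) = 1`, and `C′` ANY covariance whose pair function is `M A`:
`μ_C ⋆ (e^{q} F) = (μ_C ⋆ e^{q}) · S_M (μ_{C′} ⋆ F)` for every `F`, `S_M = ExteriorAlgebra.map (Matrix.toLin' Mᵀ)` the substitution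
`ψ(X) ↦ Σ_Z M(X,Z)ψ(Z)` — both sides are twisted Wick maps with the same data (`μ_C ⋆ e^{q}` is even, hence central) and agree at `F = 1`.
[cite: BenfattoGiulianiMastropietro2006, §2.3 (2.21)–(2.24)] -/
theorem gaussConv_grassmannExp_mul {C' : Matrix Γ Γ R}
    (hC' : ∀ X Y, ((1 / 2 : ℚ) • (1 : R)) * (C' Y X - C' X Y) = (M * A) X Y) (F : GrassmannAlgebra R Γ) :
    gaussConv R C (grassmannExp q * F) =
      gaussConv R C (grassmannExp q) * ExteriorAlgebra.map (Matrix.toLin' M.transpose) (gaussConv R C' F) := by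
  set g : GrassmannAlgebra R Γ := gaussConv R C (grassmannExp q) with hg
  set f : (Γ → R) →ₗ[R] (Γ → R) := Matrix.toLin' M.transpose with hf
  -- `g` is even, hence central
  have hgeven : g ∈ evenOdd R 0 :=
    gaussConv_mem_evenOdd R C (grassmannExp_mem_evenOdd_zero R (quadratic_mem_evenOdd_zero_of_eq N hq) (isNilpotent_of_eq_quadratic N hq))
  -- the two maps
  set Ψ : GrassmannAlgebra R Γ →ₗ[R] GrassmannAlgebra R Γ := gaussConv R C ∘ₗ LinearMap.mulLeft R (grassmannExp q) with hΨdef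
  set Θ : GrassmannAlgebra R Γ →ₗ[R] GrassmannAlgebra R Γ :=
    LinearMap.mulLeft R g ∘ₗ ((ExteriorAlgebra.map f).toLinearMap ∘ₗ gaussConv R C') with hΘdef
  have hΨapp : ∀ a, Ψ a = gaussConv R C (grassmannExp q * a) := fun a => rfl
  have hΘapp : ∀ a, Θ a = g * ExteriorAlgebra.map f (gaussConv R C' a) := fun a => rfl
  have hΨ : ∀ (X : Γ) (a : GrassmannAlgebra R Γ),
      Ψ (gen R X * a) = (∑ Z, M X Z • gen R Z) * Ψ a + ∑ Y, (M * A) X Y • Ψ (grassmannDeriv R Y a) := by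
    intro X a
    simp only [hΨapp]
    exact gaussConv_grassmannExp_mul_gen_mul_of_resolvent N hq C hA hS hM X a
  have hΘ : ∀ (X : Γ) (a : GrassmannAlgebra R Γ),
      Θ (gen R X * a) = (∑ Z, M X Z • gen R Z) * Θ a + ∑ Y, (M * A) X Y • Θ (grassmannDeriv R Y a) := by
    intro X a
    simp only [hΘapp]
    rw [gaussConv_gen_mul, map_add, map_mul, mul_add, map_toLin'_transpose_gen, ← mul_assoc,
      ((commute_of_mem_evenOdd_zero R hgeven) _).eq, mul_assoc, map_sum, Finset.mul_sum]
    congr 1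
    refine Finset.sum_congr rfl fun Y _ => ?_
    rw [hC', map_smul, grassmannDeriv_gaussConv, mul_smul_comm]
  have h1 : Ψ 1 = Θ 1 := by
    rw [hΨapp, hΘapp, mul_one, gaussConv_one, map_one, mul_one]
  have h := eq_of_twistedWick R Ψ Θ (fun X => ∑ Z, M X Z • gen R Z) (M * A) hΨ hΘ h1
  have hF := LinearMap.congr_fun h F
  rwa [hΨapp, hΘapp] at hF

/-- **Canonical form**: `μ_C ⋆ (e^{q} F) = (μ_C ⋆ e^{q}) · S_M (μ_{−MA} ⋆ F)` (the renormalised pair function `M A` is antisymmetric, so `−M A`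
is a covariance realising it). [cite: BenfattoGiulianiMastropietro2006, §2.3 (2.21)–(2.24)] -/
theorem gaussConv_grassmannExp_mul_canonical (F : GrassmannAlgebra R Γ) :
    gaussConv R C (grassmannExp q * F) =
      gaussConv R C (grassmannExp q) * ExteriorAlgebra.map (Matrix.toLin' M.transpose) (gaussConv R (-(M * A)) F) := by
  have hanti : (M * A).transpose = -(M * A) :=
    transpose_resolvent_mul_pairing R (hA ▸ transpose_pairing_eq_neg R C) (hS ▸ transpose_sub_transpose_eq_neg R N) hM
  refine gaussConv_grassmannExp_mul N hq C hA hS hM (fun X Y => ?_) F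
  have hYX : (M * A) Y X = -(M * A) X Y := by
    rw [← Matrix.transpose_apply (M * A) X Y, hanti, Matrix.neg_apply]
  rw [Matrix.neg_apply, Matrix.neg_apply, hYX, neg_neg, sub_neg_eq_add, half_smul_one_mul_add_self]

end Resolvent

/-! ### Antisymmetric covariances: `C′ = (1 + C S)⁻¹ C`, and the effective action -/

section Antisymmetric

variable {R}
variable (N : Matrix Γ Γ R) {q : GrassmannAlgebra R Γ} (hq : q = ∑ X, ∑ Y, N X Y • (gen R X * gen R Y))
variable {C S M : Matrix Γ Γ R} (hC : C.transpose = -C) (hS : S = Matrix.of fun X Y => N X Y - N Y X)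
  (hM : M * (1 + C * S) = 1)
include hq hC hS hM

/-- **A quadratic insertion renormalises an antisymmetric covariance, convolution level**: for `Cᵀ = −C`, `S = N − Nᵀ`, `M (1 + C S) = 1`,
`μ_C ⋆ (e^{Σ Nψψ} F) = (μ_C ⋆ e^{Σ Nψψ}) · S_M (μ_{M C} ⋆ F)` — the new covariance is `(1 + C S)⁻¹ C` and the external fields are substituted
by `M = 1 + (M C)·(−S)…`-dressed combinations `ψ(X) ↦ Σ_Z M(X,Z)ψ(Z)`. [cite: BenfattoGiulianiMastropietro2006, §2.3 (2.21)–(2.24)] -/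
theorem gaussConv_grassmannExp_mul_of_transpose_eq_neg (F : GrassmannAlgebra R Γ) :
    gaussConv R C (grassmannExp q * F) =
      gaussConv R C (grassmannExp q) * ExteriorAlgebra.map (Matrix.toLin' M.transpose) (gaussConv R (M * C) F) := by
  have hA := pairing_eq_neg_of_transpose_eq_neg R hC
  have hM' : M * (1 - (-C) * S) = 1 := by rwa [neg_mul, sub_neg_eq_add]
  have h := gaussConv_grassmannExp_mul_canonical N hq C hA.symm hS hM' F
  rwa [Matrix.mul_neg, neg_neg] at h

/-- **Effective Boltzmann factors**: `μ_C ⋆ e^{−(V − q)} = (μ_C ⋆ e^{q}) · S_M (μ_{MC} ⋆ e^{−V})`, i.e.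
`effBoltzmann C (V − q) = effBoltzmann C (−q) · S_M (effBoltzmann (M C) V)`. [cite: FeldmanSalmhoferTrubowitz1996, §1] -/
theorem effBoltzmann_sub_quadratic (V : GrassmannAlgebra R Γ) (hV : constPart R V = 0) :
    effBoltzmann R C (V - q) =
      effBoltzmann R C (-q) * ExteriorAlgebra.map (Matrix.toLin' M.transpose) (effBoltzmann R (M * C) V) := by
  have hqn : IsNilpotent q := isNilpotent_of_eq_quadratic N hq
  have hVn : IsNilpotent (-V) := isNilpotent_of_constPart_eq_zero R (by rw [map_neg, hV, neg_zero])
  rw [effBoltzmann, effBoltzmann, effBoltzmann, neg_sub, sub_eq_add_neg, neg_neg, grassmannExp,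
    IsNilpotent.exp_add_of_commute (commute_of_eq_quadratic N hq (-V)) hqn hVn]
  exact gaussConv_grassmannExp_mul_of_transpose_eq_neg N hq hC hS hM _

/-- **Partition functions**: `Z_C(V − q) = Z_C(−q) · Z_{MC}(V)` (the constant part is multiplicative and invariant under substitutions).
[cite: FeldmanSalmhoferTrubowitz1996, §1] -/
theorem effPartitionFn_sub_quadratic (V : GrassmannAlgebra R Γ) (hV : constPart R V = 0) :
    effPartitionFn R C (V - q) = effPartitionFn R C (-q) * effPartitionFn R (M * C) V := by
  rw [effPartitionFn, effBoltzmann_sub_quadratic N hq hC hS hM V hV, map_mul, constPart_map, effPartitionFn, effPartitionFn]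

/-- **The effective action of `V − q` splits**: for `Cᵀ = −C`, `S = N − Nᵀ`, `M (1 + C S) = 1`, `V` without constant part, and unit partition
functions `Z_C(−q)`, `Z_{MC}(V)`:
`effAction C (V − q) = effAction C (−q) + S_M (effAction (M C) V)` — the purely Gaussian (quadratic) effective action of the insertion plus the
`M`-substituted effective action of the non-quadratic part with the RENORMALISED covariance `(1 + C S)⁻¹ C` (Benfatto–Giuliani–Mastropietro
2006 (2.21)–(2.24) «the quadratic part is moved into the free measure», at the level of the Wilsonian effective action, all degrees).
[cite: BenfattoGiulianiMastropietro2006, §2.3 (2.21)–(2.24)] -/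
theorem effAction_sub_quadratic (V : GrassmannAlgebra R Γ) (hV : constPart R V = 0)
    (hZq : IsUnit (effPartitionFn R C (-q))) (hZV : IsUnit (effPartitionFn R (M * C) V)) :
    effAction R C (V - q) =
      effAction R C (-q) + ExteriorAlgebra.map (Matrix.toLin' M.transpose) (effAction R (M * C) V) := by
  set f : (Γ → R) →ₗ[R] (Γ → R) := Matrix.toLin' M.transpose with hf
  set Z₁ := effPartitionFn R C (-q) with hZ₁
  set Z₂ := effPartitionFn R (M * C) V with hZ₂
  set B₁ := effBoltzmann R C (-q) with hB₁
  set B₂ := effBoltzmann R (M * C) V with hB₂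
  -- the two «1 + nilpotent» factors
  set x : GrassmannAlgebra R Γ := Ring.inverse Z₁ • B₁ - 1 with hx
  set y : GrassmannAlgebra R Γ := Ring.inverse Z₂ • B₂ - 1 with hy
  have hx0 : constPart R x = 0 := by
    rw [hx, map_sub, map_smul, map_one, smul_eq_mul, hB₁, ← effPartitionFn, ← hZ₁, Ring.inverse_mul_cancel _ hZq, sub_self]
  have hy0 : constPart R y = 0 := by
    rw [hy, map_sub, map_smul, map_one, smul_eq_mul, hB₂, ← effPartitionFn, ← hZ₂, Ring.inverse_mul_cancel _ hZV, sub_self]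
  have hxn : IsNilpotent x := isNilpotent_of_constPart_eq_zero R hx0
  have hyn : IsNilpotent y := isNilpotent_of_constPart_eq_zero R hy0
  have hyn' : IsNilpotent (ExteriorAlgebra.map f y) := hyn.map _
  -- `x` is even (so is its logarithm, which is therefore central)
  have hqe : grassmannExp q ∈ evenOdd R 0 :=
    grassmannExp_mem_evenOdd_zero R (quadratic_mem_evenOdd_zero_of_eq N hq) (isNilpotent_of_eq_quadratic N hq)
  have hB₁e : B₁ ∈ evenOdd R 0 := by
    rw [hB₁, effBoltzmann, neg_neg]
    exact gaussConv_mem_evenOdd R C hqe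
  have hxe : x ∈ evenOdd R 0 := by
    rw [hx]
    exact Submodule.sub_mem _ (Submodule.smul_mem _ _ hB₁e) (one_mem_evenOdd_zero R)
  have hlogxe : grassmannLog1p R x ∈ evenOdd R 0 := by
    rw [grassmannLog1p]
    exact Submodule.sum_mem _ fun k _ => Submodule.smul_of_tower_mem _ _ (pow_mem_evenOdd_zero R hxe k)
  have hcomm : Commute (grassmannLog1p R x) (grassmannLog1p R (ExteriorAlgebra.map f y)) :=
    commute_of_mem_evenOdd_zero R hlogxe _
  -- the Boltzmann factor and the partition function of `V − q`
  have hB : effBoltzmann R C (V - q) = B₁ * ExteriorAlgebra.map f B₂ := effBoltzmann_sub_quadratic N hq hC hS hM V hV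
  have hZ : effPartitionFn R C (V - q) = Z₁ * Z₂ := effPartitionFn_sub_quadratic N hq hC hS hM V hV
  have hprod : Ring.inverse (effPartitionFn R C (V - q)) • effBoltzmann R C (V - q) - 1 =
      (1 + x) * (1 + ExteriorAlgebra.map f y) - 1 := by
    rw [hZ, hB, Ring.mul_inverse_rev, hx, hy, map_sub, map_one, add_sub_cancel, add_sub_cancel, map_smul,
      smul_mul_smul_comm, mul_comm (Ring.inverse Z₂) (Ring.inverse Z₁)]
  rw [effAction, hprod, grassmannLog1p_mul_of_commute R hxn hyn' hcomm, neg_add, effAction, effAction, ← hx, ← hy,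
    map_neg, map_grassmannLog1p]

end Antisymmetric

end Literature.MathematicalPhysics.QuantumLattice

end
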